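import Mathlib
import HarnessLib
import Literature.AlgebraicGeometry.HodgeTheory.ClassesSupportedOn
import Literature.AlgebraicGeometry.HodgeTheory.GysinFormalism
import Literature.AlgebraicGeometry.Motives.FamiliesVHS
import Literature.AlgebraicTopology.SingularHomology.RelativeCochainsMaps

/-!
# Crux `BlochSpreadEightFour` (stmt-HodgeConjecture-18884), line `bloch-lifts-fulton`: the supported
# lifting statement `(LC)` from the SURJECTIVITY `(LS)` of the restriction of relative cohomology
# `H²ᵖ(𝒳(ℂ), (𝒳 ∖ 𝒲)(ℂ)) → H²ᵖ(X₀(ℂ), (X₀ ∖ 𝒲_{v₀})(ℂ))`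

HONEST FRAMING: helper file (route-independent); no stub is closed; nothing here proves `BlochSpreadEightFour`,
H2, HC_AV or HC. Companion of `…SpreadOfLiftedClassIntegralFibre.lean` (p823880: the crux BY NAME from
Bloch's lifting fact and the lifting statement `(LC′) ⟸ (LC)`).

This file isolates the PURE TOPOLOGY left on the Fulton side of the line. For a map of pairs
`φ : (Y, B) → (X, A)` the long exact sequences of the pairs (the tree's `relSingularCohomology`,
`exact_toAbsolute_map`, `map_comp_toAbsolute` — Hatcher §3.1) give at once:

  if `φ^* : Hᵏ(X, A) → Hᵏ(Y, B)` is onto, then every class of `Hᵏ(Y)` dying on `B` is the pull-back of a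
  class of `Hᵏ(X)` dying on `A` (`exists_map_eq_of_surjective_relMap`).

Read on the carriers of the line (`classesSupportedOn` = kernel of the restriction to the complex points of
the complement): the supported lifting statement `(LC)` of `…SpreadOfLiftedClassIntegralFibre.lean` follows
from

  `(LS)`: for `g : 𝒳 ⟶ V` a smooth projective family over a smooth `V`, `ι : 𝒲 ↪ 𝒳` closed with `𝒲` flat
  over `V`, and `v₀ ∈ V(ℂ)` with `𝒲_{v₀}` integral of codimension exactly `p` in `𝒳_{v₀}`: the restriction
  `H²ᵖ(𝒳(ℂ), (𝒳 ∖ ι𝒲)(ℂ); ℂ) → H²ᵖ(𝒳_{v₀}(ℂ), (𝒳_{v₀} ∖ 𝒲_{v₀})(ℂ); ℂ)` along the fibre inclusion is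
  SURJECTIVE

(`liftedSupportedClass_of_surjective_relMap`) — classically: both sides are lines (purity, Fulton 19.1.1)
and at a point of `𝒲_{v₀}` where the flat `𝒲 → V` is smooth the pair `(𝒳(ℂ), 𝒲(ℂ))` is locally the
product of a ball with `(X₀(ℂ), 𝒲_{v₀}(ℂ))`, so the Thom class restricts to the Thom class (Fulton 1998
§19.2 Cor. 19.2 (b) with excess `0`; Milnor–Stasheff Thm. 10.4). `(LS)` is the exact remaining
topological debt recorded in the census of the item (decomposed there as (LS1)–(LS4)).

References: [Hatcher2002] §3.1 pp. 199–200 (long exact sequence of the pair, naturality);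
[Fulton1998] §19.1 eq. (1), Lemma 19.1.1, §19.2 Cor. 19.2 (b); [GrothendieckTopology1969] §1.
-/

-- every declaration of this problem lives in `Summit.HodgeConjecture.HodgeConjecture.…` (summit = sub-problem)
set_option linter.dupNamespace false

noncomputable section

open CategoryTheory CategoryTheory.Limits AlgebraicGeometry Order
open Literature.AlgebraicGeometry.Motives Literature.AlgebraicGeometry.HodgeTheory
open Literature.AlgebraicTopology.SingularHomology

namespace Summit.HodgeConjecture.HodgeConjecture.Theorems

/-- **Lifting classes killed by a subspace along a map of pairs.** For a map of pairs
`φ : (Y, B) → (X, A)` of topological spaces such that `φ^* : Hᵏ(X, A; F) → Hᵏ(Y, B; F)` is onto, every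
`y ∈ Hᵏ(Y; F)` restricting to zero on `B` is `φ^* x` for some `x ∈ Hᵏ(X; F)` restricting to zero on `A`:
`y` comes from `Hᵏ(Y, B)` (exactness at `Hᵏ(Y)`), lift to `Hᵏ(X, A)`, map to `Hᵏ(X)` (naturality of
`Hᵏ(–, –) → Hᵏ(–)`; the composite `Hᵏ(X, A) → Hᵏ(X) → Hᵏ(A)` vanishes).
[cite: Hatcher2002, §3.1 pp. 199–200] -/
theorem exists_map_eq_of_surjective_relMap (F : Type) [Field F] {X Y : Type} [TopologicalSpace X]
    [TopologicalSpace Y] {A : Set X} {B : Set Y} (φ : C(Y, X)) (h : Set.MapsTo φ B A) (k : ℕ)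
    (hsurj : Function.Surjective (relSingularCohomology.map F F φ h k))
    (y : singularCohomology F F Y k) (hy : singularCohomology.map F F (subsetIncl B) k y = 0) :
    ∃ x : singularCohomology F F X k, singularCohomology.map F F (subsetIncl A) k x = 0 ∧
      singularCohomology.map F F φ k x = y := by
  -- `y` comes from `Hᵏ(Y, B)`
  obtain ⟨y', hy'⟩ := ((ShortComplex.moduleCat_exact_iff _).1
    (relSingularCohomology.exact_toAbsolute_map (R := F) (M := F) B k)) y hy
  -- lift to `Hᵏ(X, A)`
  obtain ⟨x', rfl⟩ := hsurj y'
  refine ⟨relSingularCohomology.toAbsolute F F X A k x', ?_, ?_⟩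
  · -- `Hᵏ(X, A) → Hᵏ(X) → Hᵏ(A)` vanishes
    have h0 := (ShortComplex.mk (relSingularCohomology.toAbsolute F F X A k)
      (singularCohomology.map F F (subsetIncl A) k)
      (by
        change HomologicalComplex.homologyMap (relShortComplex F F A).f k ≫
          HomologicalComplex.homologyMap (relShortComplex F F A).g k = 0
        rw [← HomologicalComplex.homologyMap_comp, (relShortComplex F F A).zero,
          HomologicalComplex.homologyMap_zero])).zero
    have h1 := congrArg (fun ψ => ψ x') h0
    simpa only [ModuleCat.comp_apply, ModuleCat.hom_zero, LinearMap.zero_apply] using h1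
  · -- naturality of `Hᵏ(–, –) → Hᵏ(–)`
    rw [← hy', ← ModuleCat.comp_apply, ← relSingularCohomology.map_comp_toAbsolute,
      ModuleCat.comp_apply]

/-- The fibre inclusion `𝒳_{v₀} → 𝒳` carries the complex points off the central fibre
`𝒲_{v₀} = 𝒲 ×_𝒳 𝒳_{v₀}` of a closed subscheme `ι : 𝒲 ↪ 𝒳` into the complex points off `ι(𝒲)`
(`Set.range (𝒲_{v₀} → 𝒳_{v₀}) = (𝒳_{v₀} → 𝒳)⁻¹ ι(𝒲)`, Mathlib `Scheme.Pullback.range_snd`). [folklore] -/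
theorem mapsTo_compl_centralFibre {𝒳 V : SchemeOver ℂ} (g : 𝒳 ⟶ V) {𝒲 : Scheme} (ι : 𝒲 ⟶ 𝒳.left)
    (v₀ : ComplexPoints V) :
    Set.MapsTo (AlgPoints.mapContinuous (L := ℂ) (fiberι g v₀))
      {Q : ComplexPoints (fiberOver g v₀) | Q.pt ∉ Set.range (pullback.snd ι (fiberι g v₀).left).base}
      {P : ComplexPoints 𝒳 | P.pt ∉ Set.range ι.base} := by
  intro Q hQ hP
  apply hQ
  rw [Scheme.Pullback.range_snd]
  exact hP

/-- **`(LS) ⟹ (LC)`: the supported lifting statement of the line from the surjectivity of the restriction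
of relative cohomology to the central fibre.** For every smooth projective family `g : 𝒳 ⟶ V` over a
smooth `V`, `0 < p`, every closed `ι : 𝒲 ↪ 𝒳` flat over `V` and every `v₀ ∈ V(ℂ)` with `𝒲_{v₀}`
integral of codimension exactly `p`: if
`H²ᵖ(𝒳(ℂ), (𝒳 ∖ ι𝒲)(ℂ); ℂ) → H²ᵖ(𝒳_{v₀}(ℂ), (𝒳_{v₀} ∖ 𝒲_{v₀})(ℂ); ℂ)` is onto, then every class of
`H²ᵖ(𝒳_{v₀}(ℂ); ℂ)` supported on the image of `𝒲_{v₀}` is the restriction of a class of `H²ᵖ(𝒳(ℂ); ℂ)`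
supported on `ι(𝒲)`. (The algebro-geometric hypotheses are carried VERBATIM so that the conclusion is
literally the hypothesis `(LC)` of `BlochSpreadEightFour_of_blochLifts_of_liftedSupportedClass`; the proof
uses none of them.) [cite: Hatcher2002, §3.1 pp. 199–200] [cite: Fulton1998, §19.2 Cor. 19.2 (b)] -/
theorem liftedSupportedClass_of_surjective_relMap
    (hLS : ∀ ⦃n p : ℕ⦄ ⦃𝒳 V : SchemeOver ℂ⦄ (g : 𝒳 ⟶ V), 0 < p → IsSmoothProjectiveFamily g n →
      AlgebraicGeometry.Smooth V.hom →
      ∀ (𝒲 : Scheme) (ι : 𝒲 ⟶ 𝒳.left), IsClosedImmersion ι → Flat (ι ≫ g.left) →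
      ∀ (v₀ : ComplexPoints V), AlgebraicGeometry.IsIntegral (pullback ι (fiberι g v₀).left) →
      (∀ z : ↥(pullback ι (fiberι g v₀).left),
        (p : ℕ∞) ≤ Order.coheight ((pullback.snd ι (fiberι g v₀).left).base z)) →
      (∃ z : ↥(pullback ι (fiberι g v₀).left),
        Order.coheight ((pullback.snd ι (fiberι g v₀).left).base z) = (p : ℕ∞)) →
      Function.Surjective (relSingularCohomology.map ℂ ℂ
        (AlgPoints.mapContinuous (L := ℂ) (fiberι g v₀)) (mapsTo_compl_centralFibre g ι v₀) (2 * p))) :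
    ∀ ⦃n p : ℕ⦄ ⦃𝒳 V : SchemeOver ℂ⦄ (g : 𝒳 ⟶ V), 0 < p → IsSmoothProjectiveFamily g n →
      AlgebraicGeometry.Smooth V.hom →
      ∀ (𝒲 : Scheme) (ι : 𝒲 ⟶ 𝒳.left), IsClosedImmersion ι → Flat (ι ≫ g.left) →
      ∀ (v₀ : ComplexPoints V), AlgebraicGeometry.IsIntegral (pullback ι (fiberι g v₀).left) →
      (∀ z : ↥(pullback ι (fiberι g v₀).left),
        (p : ℕ∞) ≤ Order.coheight ((pullback.snd ι (fiberι g v₀).left).base z)) →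
      (∃ z : ↥(pullback ι (fiberι g v₀).left),
        Order.coheight ((pullback.snd ι (fiberι g v₀).left).base z) = (p : ℕ∞)) →
      ∀ y ∈ classesSupportedOn (fiberOver g v₀) (Set.range (pullback.snd ι (fiberι g v₀).left).base) (2 * p),
      ∃ Γ : complexBetti 𝒳 (2 * p),
        Γ ∈ classesSupportedOn 𝒳 (Set.range ι.base) (2 * p) ∧
        complexBetti.map (fiberι g v₀) (2 * p) Γ = y := by
  intro n p 𝒳 V g hp hg hV 𝒲 ι hι hflat v₀ hint hcodim hz y hy
  obtain ⟨Γ, hΓ0, hΓy⟩ := exists_map_eq_of_surjective_relMap ℂ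
    (AlgPoints.mapContinuous (L := ℂ) (fiberι g v₀)) (mapsTo_compl_centralFibre g ι v₀) (2 * p)
    (hLS g hp hg hV 𝒲 ι hι hflat v₀ hint hcodim hz) y (mem_classesSupportedOn_iff.1 hy)
  exact ⟨Γ, mem_classesSupportedOn_iff.2 hΓ0, hΓy⟩

end Summit.HodgeConjecture.HodgeConjecture.Theorems

end
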